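import Mathlib
import Literature.MathematicalPhysics.QuantumFieldTheory.Balaban1983to89.Beta.PoissonInterior

/-!
# β sub-cell, an1 node VECTOR-TAILS-PROP12 — the lattice Newton parametrix (engines, v1)

HONEST FRAMING. Discharging `BetaPertH` makes Bałaban's ultraviolet stability UNCONDITIONAL — a
real constructive-QFT result; it is NOT the continuum limit and NOT the Clay problem. This file is
KERNEL mathematics only: it cites nothing, asserts no `Prop`-valued published fact, and every
statement below is proved.

## What this file is for (the located gap)

The one-loop wall (`Beta.ComposedRoad.oneLoopDrift_of_composedLegInterfacePow`, binder group
(W3a)₀) asks for pointwise TAIL certificates `hFtail` / `hGtail` on the ENTRIES of the covariant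
propagator `𝒢 = Δ_a⁻¹` (`B5DeltaA169.calG`) read on the fine lattice, with constants quantified
before the tower, i.e. free of the scale `n = L^m`.  The printed localisation bounds of
[B5 = Balaban1984PropagatorsI, Prop. 1.2, (1.110)–(1.113), pp. 35–36] (tree: `B5.Ineq110_114`,
labelled hypothesis
`B5.Prop12Printed`) are SUP-SOURCE bounds,
`|(G J)(x)| ≤ O(1) e^{-δ₀|y-y'|} |J|_∞` for `x ∈ Δ(y)`, `supp J ⊂ Δ(y')`;
so are [B4 = Balaban1983RegularityDecay, (1.9)–(1.10)], [B9 = Balaban1985BackgroundPropagators,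
(3.42)–(3.47)] and Dimock's transcription
(arXiv:1108.1335, Lemma 33).  Applied to a POINT source `J = δ_{x'}` such a bound yields only
`|𝒢(x,x')| ≤ O(1) e^{-δ₀|y-y'|}`, whereas the entry is of size `n⁻²|x-x'|⁻²` near the diagonal
and `n⁻⁴ e^{-δ₀|x-x'|/n}` at distance `n` (in fine-lattice units): a sup-source bound sees neither
the `|x-x'|^{2-d}` singularity nor the `η^d = n^{-4}` weight of a lattice delta, and the loss
`η^{-d}` is exactly what the scale-free constants of the wall cannot absorb.  No printed statement
of the programme is an ENTRY bound for a fine–fine kernel with the singularity (the printed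
entrywise kernels, e.g. [B4, (1.16)], [B9, (3.48)], live on the unit lattice,
where sup-source and entry bounds coincide).

## The repair: a lattice Newton parametrix

Write `Δ_a = c·(-Δ₁) + V` with `-Δ₁` the unit-step lattice Laplacian (fine-lattice units,
`c = n²`) and `V` the bounded non-local part (`a η^d Q*Q - ∂P∂*`).  With the C¹ spline cutoff
`χ = PoissonInterior.cutoff m x'` (equal to `1` on the `m`-cube about `x'`, `0` off the
`3m`-cube, `|∇χ| ≤ 4/m`, `|∇⁺∇⁻χ| ≤ 4/m²`) and the lattice Newton potential
`G₀ = latticeGreen/2` (`Δ₁ G₀ = -δ₀`), put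

* `param m x' := χ · G₀(· - x')`  (the PARAMETRIX `h`), and
* `resid m x'` (the RESIDUAL `ρ`), defined by `Δ₁ (param m x') = -δ_{x'} + resid m x'`
  (`lap_param`).

Then `ρ` is supported in the shell `m ≤ |· - x'|_∞ ≤ 3m` and `|ρ| ≤ C_ρ m^{-d}`
(`resid_eq_zero_of_mem`, `resid_eq_zero_of_not_mem`, `abs_resid_le`), `h` is supported in the
`3m`-cube with `|h| ≤ C₀ |· - x'|^{2-d}` and `∑|h| ≤ C m²` (`param_eq_zero_of_not_mem`,
`abs_param_le`, `sum_abs_param_le`), and the resolvent algebra gives the ENTRY IDENTITY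
(`entry_eq_of_parametrix`, §1)

  `G(x,x') = (G ρ)(x) + c⁻¹ h(x) - c⁻¹ (G (V h))(x)`      whenever `G·Δ = 1`, `Δ = L + V`,
                                                          `L h = c·(δ_{x'} - ρ)`.

On the right the inverse `G` only ever meets SPREAD sources (`ρ`, `V h`), on which a sup-source
bound of (1.110)-shape is sharp; §1 turns such a CUBE-LOCALISED SUP-SOURCE BOUND (`LocBound`, the
literal shape of (1.110)) plus blockwise exponential envelopes of `ρ` and `V h` into an entry bound
with the correct singular profile `c⁻¹|h(x)|` plus an exponentially small remainder
(`norm_entry_le_of_parametrix`).  With `m ~ n`, `c = n²`, `‖ρ‖_∞ ≲ n⁻⁴`, `‖V h‖_∞ ≲ n⁻²` this is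
precisely the `d0` profile `A₀ e^{-(δ/n)|v|}/|v|²` of `Beta.SquareTable` §13 for `n²·𝒢`, with
`A₀` free of `n`, uniform in the base point and in the volume.

## Contents

* §1 `entry_eq_of_parametrix`, `LocBound`, `restrictBlk`, `norm_mulVec_le_sum`,
  `exp_convolution_le`, `norm_mulVec_le_of_envelope`, `norm_entry_le_of_parametrix` — the
  abstract dictionary, over any finite index type and any `RCLike` scalar field.
* §2 `param`, `resid`, `lap_param`, supports and envelopes on `ℤ^d`, `d ≥ 3`, importing the
  cutoff and the Newton-potential envelopes of `Beta.PoissonInterior` by name.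
* §3 `liftZ`, `castT`, `lapT`, `paramT`, `residT`, `lapT_paramT` and the envelopes
  `abs_paramT_le`, `abs_paramT_diff_le`, `abs_residT_le`, `sum_abs_paramT_le` — transport to a
  discrete torus `Π_μ ℤ/N_μ` (the Π-type of `B5Prop11Plancherel.Tor N`) through the centred lift of
  `x - x₀`, valid once the `3m`-cube and its neighbours fit inside one period (`6m + 6 ≤ N_μ`),
  with constants quantified before the volume `N` and the centre `x₀`.

The REALISATION (instantiating §1 with `X` = fine bonds of the torus, `G = calG`, the blocks of
[B5], the hypothesis `LocBound` supplied by `B5.Prop12Printed` and the envelope of `∂P∂* h` by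
`B5.Kernel126_127Printed`) is the next file of this node; nothing here depends on it.

References (context only; nothing is cited as a hypothesis; labels = the tree's bib keys / cell
index): [B5] = Balaban1984PropagatorsI, T. Bałaban, Propagators and renormalization transformations
for lattice gauge theories. I, Commun. Math. Phys. 95 (1984) 17–40 — Prop. 1.2 (1.110)–(1.114)
pp. 35–36, (1.126)–(1.127) p. 38; [B4] = Balaban1983RegularityDecay, Regularity and decay of
lattice Green's functions, Commun. Math. Phys. 89 (1983) 571–597 — (1.9)–(1.10), (1.16);
[B9] = Balaban1985BackgroundPropagators, Propagators for lattice gauge theories in a background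
field, Commun. Math. Phys. 99 (1985) 389–434 — Thm. 3.1, (3.42)–(3.48) pp. 397–398; G. F. Lawler,
Intersections of random walks (1991), §1.5–1.6 (the Newton potential).  (v1/v1.1 of this header
mislabelled these three journal references — beta-ref G-beta-24; corrected in v1.2, no declaration
touched.)
-/

namespace Literature.MathematicalPhysics.QuantumFieldTheory.Balaban1983to89.Beta.VectorTails

open Finset Real Matrix Literature.Probability.LatticeModels
open PoissonInterior

/-! ## §1 The abstract parametrix dictionary -/

section Dictionary

variable {𝕜 : Type*} [RCLike 𝕜] {X : Type*} [Fintype X]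

/-- **Entry identity of the Newton parametrix.** If `G` is a left inverse of `Δ = Lc + V` and
`h` is a parametrix for the column `x'` of `Lc⁻¹` with residual `ρ`, `Lc h = c (δ_{x'} - ρ)`,
`c ≠ 0`, then `G x x' = (G ρ) x + c⁻¹ (h x - (G (V h)) x)`. [folklore] -/
theorem entry_eq_of_parametrix [DecidableEq X] {G Δ Lc V : Matrix X X 𝕜} {c : 𝕜}
    (hG : G * Δ = 1) (hΔ : Δ = Lc + V) {x' : X} {h ρ : X → 𝕜}
    (hpar : Lc *ᵥ h = c • (Pi.single x' 1 - ρ)) (hc : c ≠ 0) (x : X) :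
    G x x' = (G *ᵥ ρ) x + c⁻¹ * (h x - (G *ᵥ (V *ᵥ h)) x) := by
  have key : G *ᵥ (Δ *ᵥ h) = h := by rw [Matrix.mulVec_mulVec, hG, Matrix.one_mulVec]
  rw [hΔ, Matrix.add_mulVec, hpar, Matrix.mulVec_add, Matrix.mulVec_smul, Matrix.mulVec_sub]
    at key
  have hsingle : (G *ᵥ (Pi.single x' (1 : 𝕜))) x = G x x' := by
    simp [Matrix.mulVec, dotProduct_single]
  have hx := congrFun key x
  simp only [Pi.add_apply, Pi.smul_apply, Pi.sub_apply, smul_eq_mul, hsingle] at hx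
  have h2 : c⁻¹ * (h x - (G *ᵥ (V *ᵥ h)) x) = G x x' - (G *ᵥ ρ) x := by
    rw [← hx]; field_simp; ring
  rw [h2]; ring

variable {Y : Type*}

/-- **The (1.110)-shape.** A CUBE-LOCALISED SUP-SOURCE bound for the operator `G`: for a source
`J` supported in the block `y'`, `|(G J)(x)| ≤ C e^{-δ₀ d(blk x, y')} ‖J‖_∞`.  This is the literal
form of [B5, (1.110)] (value component), with `blk` the block map `x ↦ y`, `x ∈ Δ(y)`; it is
a `Prop`-valued SHAPE, to be supplied by the realisation, not an assertion. [folklore] -/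
def LocBound (G : Matrix X X 𝕜) (blk : X → Y) (dist : Y → Y → ℝ) (C δ₀ : ℝ) : Prop :=
  ∀ (J : X → 𝕜) (y' : Y), (∀ z, blk z ≠ y' → J z = 0) →
    ∀ x, ‖(G *ᵥ J) x‖ ≤ C * Real.exp (-(δ₀ * dist (blk x) y')) * ‖J‖

/-- The exponential convolution estimate
`∑_{y'} e^{-δ₀ d(y,y')} e^{-δ' d(y',y₀)} ≤ S e^{-min(δ₀/2,δ') d(y,y₀)}` for a pseudo-distance with
the triangle inequality and `∑_{y'} e^{-(δ₀/2) d(y,y')} ≤ S`. [folklore] -/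
theorem exp_convolution_le [Fintype Y] {dist : Y → Y → ℝ} (hdist : ∀ a b, 0 ≤ dist a b)
    (htri : ∀ a b c, dist a c ≤ dist a b + dist b c) {δ₀ δ' S : ℝ} (hδ₀ : 0 ≤ δ₀) (hδ' : 0 ≤ δ')
    (hS : ∀ y, ∑ y', Real.exp (-(δ₀ / 2 * dist y y')) ≤ S) (y y₀ : Y) :
    ∑ y', Real.exp (-(δ₀ * dist y y')) * Real.exp (-(δ' * dist y' y₀)) ≤
      S * Real.exp (-(min (δ₀ / 2) δ' * dist y y₀)) := by
  set μ := min (δ₀ / 2) δ' with hμdef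
  have h1 : μ ≤ δ₀ / 2 := min_le_left _ _
  have h2 : μ ≤ δ' := min_le_right _ _
  have hμ : 0 ≤ μ := le_min (by linarith) hδ'
  have key : ∀ y', Real.exp (-(δ₀ * dist y y')) * Real.exp (-(δ' * dist y' y₀)) ≤
      Real.exp (-(δ₀ / 2 * dist y y')) * Real.exp (-(μ * dist y y₀)) := by
    intro y'
    rw [← Real.exp_add, ← Real.exp_add]
    apply Real.exp_le_exp.mpr
    have ha := hdist y y'
    have hb := hdist y' y₀
    have ht : μ * dist y y₀ ≤ μ * dist y y' + μ * dist y' y₀ := by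
      have := mul_le_mul_of_nonneg_left (htri y y' y₀) hμ
      rwa [mul_add] at this
    nlinarith [mul_le_mul_of_nonneg_right h1 ha, mul_le_mul_of_nonneg_right h2 hb]
  calc ∑ y', Real.exp (-(δ₀ * dist y y')) * Real.exp (-(δ' * dist y' y₀))
      ≤ ∑ y', Real.exp (-(δ₀ / 2 * dist y y')) * Real.exp (-(μ * dist y y₀)) :=
        Finset.sum_le_sum fun y' _ => key y'
    _ = (∑ y', Real.exp (-(δ₀ / 2 * dist y y'))) * Real.exp (-(μ * dist y y₀)) := by
        rw [Finset.sum_mul]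
    _ ≤ S * Real.exp (-(μ * dist y y₀)) :=
        mul_le_mul_of_nonneg_right (hS y) (Real.exp_pos _).le

variable [DecidableEq Y]

/-- The restriction of a source `J` to the block (`blk`-fibre) labelled `y`. [folklore] -/
def restrictBlk (blk : X → Y) (J : X → 𝕜) (y : Y) : X → 𝕜 :=
  fun z => if blk z = y then J z else 0

omit [Fintype X] in
/-- Elementary helper of §1 (`restrictBlk_apply_of_ne`); the statement is its own description.
[folklore] -/
theorem restrictBlk_apply_of_ne (blk : X → Y) (J : X → 𝕜) {y : Y} {z : X} (h : blk z ≠ y) :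
    restrictBlk blk J y z = 0 := by
  simp [restrictBlk, h]

omit [Fintype X] in
/-- A source is the sum of its block restrictions. [folklore] -/
theorem sum_restrictBlk [Fintype Y] (blk : X → Y) (J : X → 𝕜) :
    ∑ y, restrictBlk blk J y = J := by
  funext z
  simp [Finset.sum_apply, restrictBlk]

/-- Each block restriction is bounded, in sup norm, by the source. [folklore] -/
theorem norm_restrictBlk_le (blk : X → Y) (J : X → 𝕜) (y : Y) : ‖restrictBlk blk J y‖ ≤ ‖J‖ := by
  refine (pi_norm_le_iff_of_nonneg (norm_nonneg J)).mpr fun z => ?_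
  by_cases h : blk z = y
  · simp only [restrictBlk, h, if_true]; exact norm_le_pi_norm J z
  · simp [restrictBlk, h]

/-- Linearity: `G J = ∑_y G (J|_y)`. [folklore] -/
theorem mulVec_eq_sum_restrictBlk [Fintype Y] (G : Matrix X X 𝕜) (blk : X → Y) (J : X → 𝕜) :
    G *ᵥ J = ∑ y, G *ᵥ restrictBlk blk J y := by
  conv_lhs => rw [← sum_restrictBlk blk J]
  rw [← Matrix.mulVecLin_apply, map_sum]
  simp only [Matrix.mulVecLin_apply]

/-- Block decomposition of a sup-source bound:
`|(G J)(x)| ≤ C ∑_{y'} e^{-δ₀ d(blk x,y')} ‖J|_{y'}‖`. [folklore] -/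
theorem norm_mulVec_le_sum [Fintype Y] {G : Matrix X X 𝕜} {blk : X → Y} {dist : Y → Y → ℝ}
    {C δ₀ : ℝ}
    (hloc : LocBound G blk dist C δ₀) (J : X → 𝕜) (x : X) :
    ‖(G *ᵥ J) x‖ ≤ C * ∑ y', Real.exp (-(δ₀ * dist (blk x) y')) * ‖restrictBlk blk J y'‖ := by
  rw [mulVec_eq_sum_restrictBlk G blk J, Finset.sum_apply, Finset.mul_sum]
  refine (norm_sum_le _ _).trans (Finset.sum_le_sum fun y' _ => ?_)
  have := hloc (restrictBlk blk J y') y' (fun z hz => restrictBlk_apply_of_ne blk J hz) x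
  simpa [mul_assoc] using this

/-- **Sup-source bound on an exponentially enveloped source.** If `G` satisfies the (1.110)-shape
`LocBound` and the source `J` has blockwise envelope `‖J|_{y'}‖ ≤ K e^{-δ' d(y',y₀)}`, then
`|(G J)(x)| ≤ C K S e^{-min(δ₀/2,δ') d(blk x, y₀)}`. [folklore] -/
theorem norm_mulVec_le_of_envelope [Fintype Y] {G : Matrix X X 𝕜} {blk : X → Y} {dist : Y → Y → ℝ}
    {C δ₀ : ℝ} (hloc : LocBound G blk dist C δ₀) (hC : 0 ≤ C) (hdist : ∀ a b, 0 ≤ dist a b)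
    (htri : ∀ a b c, dist a c ≤ dist a b + dist b c) (hδ₀ : 0 ≤ δ₀) {δ' K S : ℝ} (hδ' : 0 ≤ δ')
    (hK : 0 ≤ K) (hS : ∀ y, ∑ y', Real.exp (-(δ₀ / 2 * dist y y')) ≤ S) {J : X → 𝕜} {y₀ : Y}
    (hJ : ∀ y', ‖restrictBlk blk J y'‖ ≤ K * Real.exp (-(δ' * dist y' y₀))) (x : X) :
    ‖(G *ᵥ J) x‖ ≤ C * K * S * Real.exp (-(min (δ₀ / 2) δ' * dist (blk x) y₀)) := by
  have e1 := norm_mulVec_le_sum hloc J x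
  have e2 : ∑ y', Real.exp (-(δ₀ * dist (blk x) y')) * ‖restrictBlk blk J y'‖ ≤
      K * ∑ y', Real.exp (-(δ₀ * dist (blk x) y')) * Real.exp (-(δ' * dist y' y₀)) := by
    rw [Finset.mul_sum]
    refine Finset.sum_le_sum fun y' _ => ?_
    have he := (Real.exp_pos (-(δ₀ * dist (blk x) y'))).le
    calc Real.exp (-(δ₀ * dist (blk x) y')) * ‖restrictBlk blk J y'‖
        ≤ Real.exp (-(δ₀ * dist (blk x) y')) * (K * Real.exp (-(δ' * dist y' y₀))) :=
          mul_le_mul_of_nonneg_left (hJ y') he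
      _ = K * (Real.exp (-(δ₀ * dist (blk x) y')) * Real.exp (-(δ' * dist y' y₀))) := by ring
  have e3 := exp_convolution_le hdist htri hδ₀ hδ' hS (blk x) y₀
  calc ‖(G *ᵥ J) x‖ ≤ C * ∑ y', Real.exp (-(δ₀ * dist (blk x) y')) * ‖restrictBlk blk J y'‖ := e1
    _ ≤ C * (K * (S * Real.exp (-(min (δ₀ / 2) δ' * dist (blk x) y₀)))) := by
        refine mul_le_mul_of_nonneg_left (e2.trans ?_) hC
        exact mul_le_mul_of_nonneg_left e3 hK
    _ = C * K * S * Real.exp (-(min (δ₀ / 2) δ' * dist (blk x) y₀)) := by ring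

/-- **Entry bound from the parametrix.** Under the entry identity of `entry_eq_of_parametrix`, a
(1.110)-shape bound for `G` and blockwise exponential envelopes of the residual `ρ` and of the
non-local source `V h` about the block of `x'`, the entry `G x x'` is bounded by the singular
parametrix profile `‖c‖⁻¹ ‖h x‖` plus an exponentially decaying remainder with SCALE-FREE
constants. [folklore] -/
theorem norm_entry_le_of_parametrix [DecidableEq X] [Fintype Y] {G Δ Lc V : Matrix X X 𝕜} {c : 𝕜}
    (hG : G * Δ = 1)
    (hΔ : Δ = Lc + V) {x' : X} {h ρ : X → 𝕜} (hpar : Lc *ᵥ h = c • (Pi.single x' 1 - ρ))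
    (hc : c ≠ 0) {blk : X → Y} {dist : Y → Y → ℝ} {C δ₀ : ℝ} (hloc : LocBound G blk dist C δ₀)
    (hC : 0 ≤ C) (hdist : ∀ a b, 0 ≤ dist a b) (htri : ∀ a b c, dist a c ≤ dist a b + dist b c)
    (hδ₀ : 0 ≤ δ₀) {δ' S Kρ KV : ℝ} (hδ' : 0 ≤ δ')
    (hS : ∀ y, ∑ y', Real.exp (-(δ₀ / 2 * dist y y')) ≤ S) (hKρ : 0 ≤ Kρ) (hKV : 0 ≤ KV)
    (hρ : ∀ y', ‖restrictBlk blk ρ y'‖ ≤ Kρ * Real.exp (-(δ' * dist y' (blk x'))))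
    (hVh : ∀ y', ‖restrictBlk blk (V *ᵥ h) y'‖ ≤ KV * Real.exp (-(δ' * dist y' (blk x'))))
    (x : X) :
    ‖G x x'‖ ≤ ‖c‖⁻¹ * ‖h x‖ +
      C * S * (Kρ + ‖c‖⁻¹ * KV) * Real.exp (-(min (δ₀ / 2) δ' * dist (blk x) (blk x'))) := by
  rw [entry_eq_of_parametrix hG hΔ hpar hc x]
  have e1 := norm_mulVec_le_of_envelope hloc hC hdist htri hδ₀ hδ' hKρ hS hρ x
  have e2 := norm_mulVec_le_of_envelope hloc hC hdist htri hδ₀ hδ' hKV hS hVh x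
  set E := Real.exp (-(min (δ₀ / 2) δ' * dist (blk x) (blk x'))) with hE
  have e3 : ‖c⁻¹ * (h x - (G *ᵥ (V *ᵥ h)) x)‖ ≤ ‖c‖⁻¹ * (‖h x‖ + C * KV * S * E) := by
    rw [norm_mul, norm_inv]
    refine mul_le_mul_of_nonneg_left ((norm_sub_le _ _).trans ?_) (inv_nonneg.mpr (norm_nonneg c))
    linarith
  calc ‖(G *ᵥ ρ) x + c⁻¹ * (h x - (G *ᵥ (V *ᵥ h)) x)‖
      ≤ ‖(G *ᵥ ρ) x‖ + ‖c⁻¹ * (h x - (G *ᵥ (V *ᵥ h)) x)‖ := norm_add_le _ _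
    _ ≤ C * Kρ * S * E + ‖c‖⁻¹ * (‖h x‖ + C * KV * S * E) := add_le_add e1 e3
    _ = ‖c‖⁻¹ * ‖h x‖ + C * S * (Kρ + ‖c‖⁻¹ * KV) * E := by ring

end Dictionary

/-! ## §2 The lattice Newton parametrix on `ℤ^d`, `d ≥ 3` -/

section Parametrix

variable {d : ℕ}

/-- The PARAMETRIX `h = χ · G₀(· - x')`: the Newton potential of `ℤ^d` centred at `x'`, cut off
by the C¹ spline `PoissonInterior.cutoff m x'` (equal to `1` on `cube x' m`, `0` off
`cube x' (3m-1)`). [folklore] -/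
noncomputable def param (m : ℕ) (x' y : Site d) : ℝ := cutoff m x' y * G₀ (y - x')

/-- The RESIDUAL `ρ` of the parametrix, `Δ₁ h = -δ_{x'} + ρ` (`lap_param`): the cross terms of
the product rule, `∑ᵢ (∇ᵢ⁺χ · G₀(· + eᵢ - x') + ∇ᵢ⁻χ · G₀(· - eᵢ - x'))`. [folklore] -/
noncomputable def resid (m : ℕ) (x' y : Site d) : ℝ :=
  ∑ i : Fin d, ((cutoff m x' (y + Pi.single i 1) - cutoff m x' y) * G₀ (y + Pi.single i 1 - x') +
    (cutoff m x' (y - Pi.single i 1) - cutoff m x' y) * G₀ (y - Pi.single i 1 - x'))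

/-- Translation covariance of the lattice Laplacian. [folklore] -/
theorem lap_translate (u : Site d → ℝ) (x' y : Site d) :
    latticeLaplacianZd (fun z => u (z - x')) y = latticeLaplacianZd u (y - x') := by
  rw [latticeLaplacianZd_def, latticeLaplacianZd_def]
  congr 1
  refine Finset.sum_congr rfl fun i _ => ?_
  rw [add_sub_right_comm, sub_right_comm]

/-- **The parametrix equation** `Δ₁ h = -δ_{x'} + ρ`. [folklore] -/
theorem lap_param (hd : 3 ≤ d) (m : ℕ) (x' y : Site d) :
    latticeLaplacianZd (param m x') y = -(if y = x' then 1 else 0) + resid m x' y := by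
  have hp : param m x' = fun z => cutoff m x' z * G₀ (z - x') := rfl
  rw [hp, lap_mul (cutoff m x') (fun z => G₀ (z - x')) y, lap_translate, lap_G₀ hd]
  have hδ : cutoff m x' y * -(if y - x' = 0 then (1 : ℝ) else 0) = -(if y = x' then 1 else 0) := by
    by_cases hy : y = x'
    · subst hy; simp [cutoff_self]
    · simp [hy, sub_ne_zero.mpr hy]
  rw [hδ]
  rfl

/-- The parametrix is supported in `cube x' (3m-1)`. [folklore] -/
theorem param_eq_zero_of_not_mem {m : ℕ} (hm : 1 ≤ m) {x' y : Site d}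
    (h : y ∉ cube x' (3 * m - 1)) : param m x' y = 0 := by
  simp [param, cutoff_eq_zero_of_not_mem hm h]

/-- On the inner cube `cube x' m` the parametrix IS the Newton potential. [folklore] -/
theorem param_eq_G₀_of_mem {m : ℕ} {x' y : Site d} (h : y ∈ cube x' m) :
    param m x' y = G₀ (y - x') := by
  rw [param, cutoff_eq_one (mem_cube.mp h), one_mul]

/-- Envelope of the parametrix: `|h(y)| ≤ C₀ |y - x'|^{2-d}` (with `|·| = nrm = max(1,|·|_∞)`).
[folklore] -/
theorem abs_param_le (hd : 3 ≤ d) : ∃ C₀ : ℝ, 0 ≤ C₀ ∧ ∀ (m : ℕ), 1 ≤ m →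
    ∀ x' y : Site d, |param m x' y| ≤ C₀ / nrm (y - x') ^ (d - 2) := by
  obtain ⟨C₀, hC₀, hG⟩ := G₀_bound hd
  refine ⟨C₀, hC₀, fun m hm x' y => ?_⟩
  rw [param, abs_mul]
  calc |cutoff m x' y| * |G₀ (y - x')| ≤ 1 * (C₀ / nrm (y - x') ^ (d - 2)) :=
        mul_le_mul (abs_cutoff_le_one hm x' y) (hG _) (abs_nonneg _) zero_le_one
    _ = C₀ / nrm (y - x') ^ (d - 2) := one_mul _

/-- `ℓ¹` mass of the parametrix: `∑_y |h(y)| ≤ C m²` (dimension-free exponent, since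
`∑_{|z| ≤ R} |z|^{2-d} ≲ R²`). [folklore] -/
theorem sum_abs_param_le (hd : 3 ≤ d) : ∃ C : ℝ, 0 ≤ C ∧ ∀ (m : ℕ), 1 ≤ m →
    ∀ x' : Site d, ∑ y ∈ cube x' (3 * m - 1), |param m x' y| ≤ C * (m : ℝ) ^ 2 := by
  have hd0 : 0 < d := by omega
  obtain ⟨C₀, hC₀, hP⟩ := abs_param_le hd
  refine ⟨C₀ * (1 + 2 * d * 3 ^ (d - 1) * 9), by positivity, fun m hm x' => ?_⟩
  have hm1 : (1 : ℝ) ≤ m := by exact_mod_cast hm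
  -- shift the cube to the origin
  have hshift : ∑ y ∈ cube x' (3 * m - 1), |param m x' y| =
      ∑ z ∈ cube (0 : Site d) (3 * m - 1), |param m x' (z + x')| := by
    refine Finset.sum_nbij' (fun y => y - x') (fun z => z + x') ?_ ?_ ?_ ?_ ?_
    · intro y hy
      rw [mem_cube_iff_supNorm] at hy ⊢
      simpa using hy
    · intro z hz
      rw [mem_cube_iff_supNorm] at hz ⊢
      simpa using hz
    · intro y _; simp
    · intro z _; simp
    · intro y _; simp
  rw [hshift]
  calc ∑ z ∈ cube (0 : Site d) (3 * m - 1), |param m x' (z + x')|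
      ≤ ∑ z ∈ cube (0 : Site d) (3 * m - 1), C₀ * (1 / nrm z ^ (d - 2)) := by
        refine Finset.sum_le_sum fun z _ => ?_
        have := hP m hm x' (z + x')
        rw [add_sub_cancel_right] at this
        rwa [mul_one_div]
    _ = C₀ * ∑ z ∈ cube (0 : Site d) (3 * m - 1), 1 / nrm z ^ (d - 2) := by rw [Finset.mul_sum]
    _ ≤ C₀ * (1 + 2 * d * 3 ^ (d - 1) * ((3 * m - 1 : ℕ) : ℝ) ^ (d - (d - 2))) :=
        mul_le_mul_of_nonneg_left (sum_cube_inv_nrm_pow_le hd0 _ _ (by omega)) hC₀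
    _ ≤ C₀ * (1 + 2 * d * 3 ^ (d - 1) * 9) * (m : ℝ) ^ 2 := by
        have h2 : d - (d - 2) = 2 := by omega
        rw [h2]
        have h3 : ((3 * m - 1 : ℕ) : ℝ) ≤ 3 * m := by
          have : (3 * m - 1 : ℕ) ≤ 3 * m := Nat.sub_le _ _
          exact_mod_cast this
        have h4 : ((3 * m - 1 : ℕ) : ℝ) ^ 2 ≤ 9 * (m : ℝ) ^ 2 := by
          calc ((3 * m - 1 : ℕ) : ℝ) ^ 2 ≤ (3 * m) ^ 2 := by gcongr
            _ = 9 * (m : ℝ) ^ 2 := by ring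
        have h5 : (1 : ℝ) ≤ (m : ℝ) ^ 2 := by nlinarith
        have h6 : (0 : ℝ) ≤ 2 * d * 3 ^ (d - 1) := by positivity
        nlinarith [mul_le_mul_of_nonneg_left h4 h6, mul_nonneg hC₀ h6]

/-- The residual vanishes on the inner cube `cube x' (m-1)` (where `χ ≡ 1` at `y` and all its
neighbours). [folklore] -/
theorem resid_eq_zero_of_mem {m : ℕ} {x' y : Site d} (h : y ∈ cube x' (m - 1)) (hm : 1 ≤ m) :
    resid m x' y = 0 := by
  have h' : ∀ j, |y j - x' j| + 1 ≤ (m : ℤ) := by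
    intro j
    have := (mem_cube.mp h) j
    have e : ((m - 1 : ℕ) : ℤ) = m - 1 := by omega
    rw [e] at this
    linarith
  refine Finset.sum_eq_zero fun i _ => ?_
  obtain ⟨h0, h1, h2⟩ := cutoff_shift_eq_one h' i
  rw [h0, h1, h2]; ring

/-- The residual is supported in `cube x' (3m)`. [folklore] -/
theorem resid_eq_zero_of_not_mem {m : ℕ} (hm : 1 ≤ m) {x' y : Site d}
    (h : y ∉ cube x' (3 * m)) : resid m x' y = 0 := by
  have e3 : 3 * m - 1 + 1 = 3 * m := by omega
  have hy : y ∉ cube x' (3 * m - 1) := fun hy => h (cube_mono (by omega) hy)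
  have hplus : ∀ i : Fin d, y + Pi.single i 1 ∉ cube x' (3 * m - 1) := by
    intro i hi
    have := sub_mem_cube_succ hi (supNorm_single_one i)
    rw [add_sub_cancel_right, e3] at this
    exact h this
  have hminus : ∀ i : Fin d, y - Pi.single i 1 ∉ cube x' (3 * m - 1) := by
    intro i hi
    have := add_mem_cube_succ hi (supNorm_single_one i)
    rw [sub_add_cancel, e3] at this
    exact h this
  refine Finset.sum_eq_zero fun i _ => ?_
  rw [cutoff_eq_zero_of_not_mem hm hy, cutoff_eq_zero_of_not_mem hm (hplus i),
    cutoff_eq_zero_of_not_mem hm (hminus i)]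
  ring

/-- Off the inner cube the displacement has sup-norm at least `m`. [folklore] -/
theorem le_supNorm_of_not_mem {m : ℕ} {x' y : Site d} (h : y ∉ cube x' (m - 1)) (hm : 1 ≤ m) :
    m ≤ supNorm (y - x') := by
  rw [mem_cube_iff_supNorm] at h
  omega

/-- **Residual envelope** `|ρ(y)| ≤ C_ρ m^{-d}` (everywhere; `ρ` lives on the shell
`m ≤ |y - x'|_∞ ≤ 3m`, where `|∇χ| ≤ 4/m` meets `|∇G₀| ≲ m^{1-d}` and `|∇⁺∇⁻χ| ≤ 4/m²` meets
`|G₀| ≲ m^{2-d}`). [folklore] -/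
theorem abs_resid_le (hd : 3 ≤ d) : ∃ Cρ : ℝ, 0 ≤ Cρ ∧ ∀ (m : ℕ), 1 ≤ m →
    ∀ x' y : Site d, |resid m x' y| ≤ Cρ / (m : ℝ) ^ d := by
  obtain ⟨C₀, hC₀, hG⟩ := G₀_bound hd
  obtain ⟨C₁, hC₁, hdG⟩ := G₀_diff_bound hd
  set A : ℝ := 4 * (2 * C₁) * 2 ^ (d - 1) + 4 * C₀ * 2 ^ (d - 2) with hA
  have hA0 : 0 ≤ A := by positivity
  refine ⟨d * A, by positivity, fun m hm x' y => ?_⟩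
  have hmpos : (0 : ℝ) < m := by exact_mod_cast hm
  by_cases hy : y ∈ cube x' (m - 1)
  · rw [resid_eq_zero_of_mem hy hm, abs_zero]; positivity
  have hsup : m ≤ supNorm (y - x') := le_supNorm_of_not_mem hy hm
  set v := y - x' with hv
  have hnv : (m : ℝ) / 2 ≤ nrm v := half_le_nrm hsup
  have term : ∀ i : Fin d,
      |(cutoff m x' (y + Pi.single i 1) - cutoff m x' y) * G₀ (y + Pi.single i 1 - x') +
        (cutoff m x' (y - Pi.single i 1) - cutoff m x' y) * G₀ (y - Pi.single i 1 - x')| ≤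
      A / (m : ℝ) ^ d := by
    intro i
    set e : Site d := Pi.single i 1 with he
    have hpe : y + e - x' = v + e := by rw [hv]; abel
    have hme : y - e - x' = v - e := by rw [hv]; abel
    rw [hpe, hme]
    have alg : (cutoff m x' (y + e) - cutoff m x' y) * G₀ (v + e) +
        (cutoff m x' (y - e) - cutoff m x' y) * G₀ (v - e) =
        (cutoff m x' (y + e) - cutoff m x' y) * (G₀ (v + e) - G₀ (v - e)) +
        (cutoff m x' (y + e) - 2 * cutoff m x' y + cutoff m x' (y - e)) * G₀ (v - e) := by ring
    rw [alg]
    -- the four factors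
    have f1 : |cutoff m x' (y + e) - cutoff m x' y| ≤ 4 / m := (cutoff_diff_le hm x' y i).1
    have f2 : |G₀ (v + e) - G₀ (v - e)| ≤ 2 * C₁ * (2 ^ (d - 1) / (m : ℝ) ^ (d - 1)) := by
      have hb := inv_nrm_pow_le hm (p := d - 1) hnv
      have g1 := (hdG v i).1
      have g2 := (hdG v i).2
      have : |G₀ (v + e) - G₀ (v - e)| ≤ |G₀ (v + e) - G₀ v| + |G₀ (v - e) - G₀ v| := by
        have := abs_sub_le (G₀ (v + e)) (G₀ v) (G₀ (v - e))
        rwa [abs_sub_comm (G₀ v) (G₀ (v - e))] at this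
      calc |G₀ (v + e) - G₀ (v - e)| ≤ C₁ / nrm v ^ (d - 1) + C₁ / nrm v ^ (d - 1) :=
            this.trans (add_le_add g1 g2)
        _ = 2 * C₁ * (1 / nrm v ^ (d - 1)) := by ring
        _ ≤ 2 * C₁ * (2 ^ (d - 1) / (m : ℝ) ^ (d - 1)) :=
            mul_le_mul_of_nonneg_left hb (by positivity)
    have f3 : |cutoff m x' (y + e) - 2 * cutoff m x' y + cutoff m x' (y - e)| ≤ 4 / (m : ℝ) ^ 2 :=
      cutoff_diff2_le hm x' y i
    have f4 : |G₀ (v - e)| ≤ C₀ * (2 ^ (d - 2) / (m : ℝ) ^ (d - 2)) := by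
      have hnve : (m : ℝ) / 2 ≤ nrm (v - e) := by
        rw [sub_eq_add_neg]
        exact half_le_nrm_add hsup (by rw [supNorm_neg]; exact supNorm_single_one i)
      have hb := inv_nrm_pow_le hm (p := d - 2) hnve
      calc |G₀ (v - e)| ≤ C₀ / nrm (v - e) ^ (d - 2) := hG _
        _ = C₀ * (1 / nrm (v - e) ^ (d - 2)) := by ring
        _ ≤ C₀ * (2 ^ (d - 2) / (m : ℝ) ^ (d - 2)) := mul_le_mul_of_nonneg_left hb hC₀
    -- assemble
    have pw1 : (4 / (m : ℝ)) * (2 * C₁ * (2 ^ (d - 1) / (m : ℝ) ^ (d - 1))) =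
        4 * (2 * C₁) * 2 ^ (d - 1) / (m : ℝ) ^ d := by
      have : (m : ℝ) ^ d = (m : ℝ) * (m : ℝ) ^ (d - 1) := by
        rw [← pow_succ']; congr 1; omega
      rw [this]; field_simp
    have pw2 : (4 / (m : ℝ) ^ 2) * (C₀ * (2 ^ (d - 2) / (m : ℝ) ^ (d - 2))) =
        4 * C₀ * 2 ^ (d - 2) / (m : ℝ) ^ d := by
      have : (m : ℝ) ^ d = (m : ℝ) ^ 2 * (m : ℝ) ^ (d - 2) := by
        rw [← pow_add]; congr 1; omega
      rw [this]; field_simp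
    calc |(cutoff m x' (y + e) - cutoff m x' y) * (G₀ (v + e) - G₀ (v - e)) +
          (cutoff m x' (y + e) - 2 * cutoff m x' y + cutoff m x' (y - e)) * G₀ (v - e)|
        ≤ |cutoff m x' (y + e) - cutoff m x' y| * |G₀ (v + e) - G₀ (v - e)| +
          |cutoff m x' (y + e) - 2 * cutoff m x' y + cutoff m x' (y - e)| * |G₀ (v - e)| := by
          rw [← abs_mul, ← abs_mul]; exact abs_add_le _ _
      _ ≤ (4 / (m : ℝ)) * (2 * C₁ * (2 ^ (d - 1) / (m : ℝ) ^ (d - 1))) +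
          (4 / (m : ℝ) ^ 2) * (C₀ * (2 ^ (d - 2) / (m : ℝ) ^ (d - 2))) := by
          exact add_le_add (mul_le_mul f1 f2 (abs_nonneg _) (by positivity))
            (mul_le_mul f3 f4 (abs_nonneg _) (by positivity))
      _ = A / (m : ℝ) ^ d := by rw [pw1, pw2, hA]; ring
  calc |resid m x' y| ≤ ∑ i : Fin d,
        |(cutoff m x' (y + Pi.single i 1) - cutoff m x' y) * G₀ (y + Pi.single i 1 - x') +
          (cutoff m x' (y - Pi.single i 1) - cutoff m x' y) * G₀ (y - Pi.single i 1 - x')| :=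
        Finset.abs_sum_le_sum_abs _ _
    _ ≤ ∑ _i : Fin d, A / (m : ℝ) ^ d := Finset.sum_le_sum fun i _ => term i
    _ = d * A / (m : ℝ) ^ d := by
        rw [Finset.sum_const, Finset.card_univ, Fintype.card_fin, nsmul_eq_mul]; ring

/-- **Gradient envelope of the parametrix** `|h(y + eᵢ) - h(y)| ≤ C₁' |y - x'|^{1-d}`: the input
of the `d1` (gradient-leg) entries. [folklore] -/
theorem abs_param_diff_le (hd : 3 ≤ d) : ∃ C : ℝ, 0 ≤ C ∧ ∀ (m : ℕ), 1 ≤ m →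
    ∀ (x' y : Site d) (i : Fin d),
      |param m x' (y + Pi.single i 1) - param m x' y| ≤ C / nrm (y - x') ^ (d - 1) := by
  obtain ⟨C₀, hC₀, hG⟩ := G₀_bound hd
  obtain ⟨C₁, hC₁, hdG⟩ := G₀_diff_bound hd
  refine ⟨C₁ + 24 * C₀, by positivity, fun m hm x' y i => ?_⟩
  have hmpos : (0 : ℝ) < m := by exact_mod_cast hm
  set e : Site d := Pi.single i 1 with he
  set v := y - x' with hv
  have hpe : y + e - x' = v + e := by rw [hv]; abel
  -- product rule: χ(y+e) (G₀(v+e) - G₀ v) + (χ(y+e) - χ y) G₀ v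
  have alg : param m x' (y + e) - param m x' y =
      cutoff m x' (y + e) * (G₀ (v + e) - G₀ v) + (cutoff m x' (y + e) - cutoff m x' y) * G₀ v := by
    simp only [param]; rw [hpe]; ring
  rw [alg]
  have t1 : |cutoff m x' (y + e) * (G₀ (v + e) - G₀ v)| ≤ C₁ / nrm v ^ (d - 1) := by
    rw [abs_mul]
    calc |cutoff m x' (y + e)| * |G₀ (v + e) - G₀ v| ≤ 1 * (C₁ / nrm v ^ (d - 1)) :=
          mul_le_mul (abs_cutoff_le_one hm x' _) (hdG v i).1 (abs_nonneg _) zero_le_one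
      _ = C₁ / nrm v ^ (d - 1) := one_mul _
  have t2 : |(cutoff m x' (y + e) - cutoff m x' y) * G₀ v| ≤ 24 * C₀ / nrm v ^ (d - 1) := by
    -- either both `y, y+e` lie outside `cube x' (3m-1)` (the difference vanishes) or
    -- `|v|_∞ ≤ 3m`, whence `4/m ≤ 12/|v| ≤ 24/nrm v`... precisely `(4/m)/nrm^{d-2} ≤ 24/nrm^{d-1}`
    by_cases hfar : y ∉ cube x' (3 * m - 1) ∧ y + e ∉ cube x' (3 * m - 1)
    · rw [cutoff_eq_zero_of_not_mem hm hfar.1, cutoff_eq_zero_of_not_mem hm hfar.2]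
      simp only [sub_self, zero_mul, abs_zero]
      exact div_nonneg (by positivity) (pow_nonneg (nrm_pos v).le _)
    · -- `nrm v ≤ 3m + ... ≤ 6m`? we use `nrm v ≤ 3m` when `y ∈ cube`, `≤ 3m` also when `y+e ∈ cube`
      have hnear : (supNorm v : ℝ) ≤ 3 * m := by
        rw [not_and_or, not_not, not_not] at hfar
        rcases hfar with hin | hin
        · rw [mem_cube_iff_supNorm] at hin
          have : supNorm v ≤ 3 * m := hin.trans (Nat.sub_le _ _)
          exact_mod_cast this
        · have hin' := sub_mem_cube_succ hin (supNorm_single_one i)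
          rw [add_sub_cancel_right, mem_cube_iff_supNorm] at hin'
          have : supNorm v ≤ 3 * m := hin'.trans (by omega)
          exact_mod_cast this
      have hnrm : nrm v ≤ 3 * m := by
        unfold nrm
        refine max_le ?_ hnear
        have : (1 : ℝ) ≤ m := by exact_mod_cast hm
        linarith
      rw [abs_mul]
      have f1 : |cutoff m x' (y + e) - cutoff m x' y| ≤ 4 / m := (cutoff_diff_le hm x' y i).1
      have hnp : 0 < nrm v := nrm_pos v
      calc |cutoff m x' (y + e) - cutoff m x' y| * |G₀ v| ≤ (4 / m) * (C₀ / nrm v ^ (d - 2)) :=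
            mul_le_mul f1 (hG v) (abs_nonneg _) (by positivity)
        _ = (4 * C₀ / nrm v ^ (d - 2)) * (1 / m) := by ring
        _ ≤ (4 * C₀ / nrm v ^ (d - 2)) * (6 / nrm v) := by
            refine mul_le_mul_of_nonneg_left ?_
              (div_nonneg (by positivity) (pow_nonneg (nrm_pos v).le _))
            rw [div_le_div_iff₀ hmpos hnp]
            linarith
        _ = 24 * C₀ / nrm v ^ (d - 1) := by
            have : nrm v ^ (d - 1) = nrm v ^ (d - 2) * nrm v := by
              rw [← pow_succ]; congr 1; omega
            rw [this]; field_simp; ring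
  calc |cutoff m x' (y + e) * (G₀ (v + e) - G₀ v) + (cutoff m x' (y + e) - cutoff m x' y) * G₀ v|
      ≤ |cutoff m x' (y + e) * (G₀ (v + e) - G₀ v)| +
          |(cutoff m x' (y + e) - cutoff m x' y) * G₀ v| := abs_add_le _ _
    _ ≤ C₁ / nrm v ^ (d - 1) + 24 * C₀ / nrm v ^ (d - 1) := add_le_add t1 t2
    _ = (C₁ + 24 * C₀) / nrm v ^ (d - 1) := by ring

/-- Translation covariance of the parametrix in the SOURCE point: differencing the source is
differencing the observation point, `h_{x'+e}(y) = h_{x'}(y - e)`. [folklore] -/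
theorem param_translate (m : ℕ) (x' e y : Site d) : param m (x' + e) y = param m x' (y - e) := by
  simp only [param, cutoff]
  congr 1
  · refine Finset.prod_congr rfl fun j _ => ?_
    congr 1; simp only [Pi.add_apply, Pi.sub_apply]; ring
  · congr 1; abel

/-- Translation covariance of the residual in the source point. [folklore] -/
theorem resid_translate (m : ℕ) (x' e y : Site d) : resid m (x' + e) y = resid m x' (y - e) := by
  simp only [resid]
  refine Finset.sum_congr rfl fun i _ => ?_
  have hc : ∀ z : Site d, cutoff m (x' + e) z = cutoff m x' (z - e) := by
    intro z
    simp only [cutoff]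
    refine Finset.prod_congr rfl fun j _ => ?_
    congr 1; simp only [Pi.add_apply, Pi.sub_apply]; ring
  rw [hc, hc, hc]
  have e1 : y + Pi.single i 1 - e = y - e + Pi.single i 1 := by abel
  have e2 : y - Pi.single i 1 - e = y - e - Pi.single i 1 := by abel
  have e3 : y + Pi.single i 1 - (x' + e) = y - e + Pi.single i 1 - x' := by abel
  have e4 : y - Pi.single i 1 - (x' + e) = y - e - Pi.single i 1 - x' := by abel
  rw [e1, e2, e3, e4]

end Parametrix

/-! ## §3 Transport to a discrete torus

The fine lattice of [B5] is a torus `Π_μ ℤ/N_μ` (tree: `B5Prop11Plancherel.Tor N`, the same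
Π-type as below).  The parametrix of §2, centred at the origin and read through the centred lift
`liftZ : Π_μ ℤ/N_μ → ℤ^d` of `x - x₀`, is a parametrix for the graph Laplacian `lapT` of the torus
as soon as the `3m`-cube and its neighbours fit strictly inside one period (`6m + 6 ≤ N_μ`); all
envelopes transport verbatim, with constants free of `N` and of the centre `x₀`. -/

section Torus

variable {d : ℕ}

/-- The centred lift `Π_μ ℤ/N_μ → ℤ^d` (coordinatewise `ZMod.valMinAbs`). [folklore] -/
def liftZ {N : Fin d → ℕ} (z : (μ : Fin d) → ZMod (N μ)) : Site d := fun μ => (z μ).valMinAbs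

/-- The reduction `ℤ^d → Π_μ ℤ/N_μ`. [folklore] -/
def castT (N : Fin d → ℕ) (w : Site d) : (μ : Fin d) → ZMod (N μ) :=
  fun μ => ((w μ : ℤ) : ZMod (N μ))

/-- Elementary helper of §3 (`castT_add`); the statement is its own description. [folklore] -/
theorem castT_add (N : Fin d → ℕ) (v w : Site d) : castT N (v + w) = castT N v + castT N w := by
  funext μ; simp [castT]

/-- Elementary helper of §3 (`castT_neg`); the statement is its own description. [folklore] -/
theorem castT_neg (N : Fin d → ℕ) (w : Site d) : castT N (-w) = -castT N w := by
  funext μ; simp [castT]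

/-- Elementary helper of §3 (`castT_single`); the statement is its own description. [folklore] -/
theorem castT_single (N : Fin d → ℕ) (i : Fin d) : castT N (Pi.single i 1) = Pi.single i 1 := by
  funext μ
  by_cases h : μ = i
  · subst h; simp [castT]
  · simp [castT, h]

/-- `castT ∘ liftZ = id`. [folklore] -/
theorem castT_liftZ {N : Fin d → ℕ} (z : (μ : Fin d) → ZMod (N μ)) : castT N (liftZ z) = z :=
  funext fun μ => ZMod.coe_valMinAbs (z μ)

/-- The lift is injective. [folklore] -/
theorem liftZ_injective {N : Fin d → ℕ} : Function.Injective (liftZ (N := N)) := by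
  intro z₁ z₂ h
  rw [← castT_liftZ z₁, ← castT_liftZ z₂, h]

/-- Elementary helper of §3 (`liftZ_zero`); the statement is its own description. [folklore] -/
theorem liftZ_zero {N : Fin d → ℕ} : liftZ (0 : (μ : Fin d) → ZMod (N μ)) = 0 :=
  funext fun _ => ZMod.valMinAbs_zero _

/-- Elementary helper of §3 (`liftZ_eq_zero_iff`); the statement is its own description.
[folklore] -/
theorem liftZ_eq_zero_iff {N : Fin d → ℕ} {z : (μ : Fin d) → ZMod (N μ)} :
    liftZ z = 0 ↔ z = 0 := by
  constructor
  · intro h; funext μ; exact (ZMod.valMinAbs_eq_zero _).mp (congrFun h μ)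
  · rintro rfl; exact liftZ_zero

/-- The graph Laplacian of the discrete torus `Π_μ ℤ/N_μ` (same normalisation as
`latticeLaplacianZd`: `∑ᵢ (f(x+eᵢ) + f(x-eᵢ)) - 2d f(x)`). [folklore] -/
def lapT {N : Fin d → ℕ} (f : ((μ : Fin d) → ZMod (N μ)) → ℝ) (x : (μ : Fin d) → ZMod (N μ)) :
    ℝ :=
  ∑ i : Fin d, (f (x + Pi.single i 1) + f (x - Pi.single i 1)) - 2 * d * f x

/-- The TORUS PARAMETRIX centred at `x₀`: `h_{x₀}(x) = param m 0 (liftZ (x - x₀))`. [folklore] -/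
noncomputable def paramT {N : Fin d → ℕ} (m : ℕ) (x₀ x : (μ : Fin d) → ZMod (N μ)) : ℝ :=
  param m 0 (liftZ (x - x₀))

/-- The TORUS RESIDUAL centred at `x₀`: `ρ_{x₀}(x) = resid m 0 (liftZ (x - x₀))`. [folklore] -/
noncomputable def residT {N : Fin d → ℕ} (m : ℕ) (x₀ x : (μ : Fin d) → ZMod (N μ)) : ℝ :=
  resid m 0 (liftZ (x - x₀))

/-- The torus parametrix is supported where `liftZ (x - x₀) ∈ cube 0 (3m-1)`. [folklore] -/
theorem paramT_eq_zero_of_not_mem {N : Fin d → ℕ} {m : ℕ} (hm : 1 ≤ m)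
    {x₀ x : (μ : Fin d) → ZMod (N μ)} (h : liftZ (x - x₀) ∉ cube 0 (3 * m - 1)) :
    paramT m x₀ x = 0 :=
  param_eq_zero_of_not_mem hm h

/-- The torus residual vanishes on the inner cube. [folklore] -/
theorem residT_eq_zero_of_mem {N : Fin d → ℕ} {m : ℕ} (hm : 1 ≤ m)
    {x₀ x : (μ : Fin d) → ZMod (N μ)} (h : liftZ (x - x₀) ∈ cube 0 (m - 1)) :
    residT m x₀ x = 0 :=
  resid_eq_zero_of_mem h hm

/-- The torus residual is supported in the `3m`-cube. [folklore] -/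
theorem residT_eq_zero_of_not_mem {N : Fin d → ℕ} {m : ℕ} (hm : 1 ≤ m)
    {x₀ x : (μ : Fin d) → ZMod (N μ)} (h : liftZ (x - x₀) ∉ cube 0 (3 * m)) :
    residT m x₀ x = 0 :=
  resid_eq_zero_of_not_mem hm h

variable {N : Fin d → ℕ} [hN : ∀ μ, NeZero (N μ)]

/-- The lift lands in the centred box: `|liftZ z μ| ≤ N_μ / 2`. [folklore] -/
theorem natAbs_liftZ_le (z : (μ : Fin d) → ZMod (N μ)) (μ : Fin d) :
    (liftZ z μ).natAbs ≤ N μ / 2 :=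
  ZMod.natAbs_valMinAbs_le _

/-- Uniqueness of the centred representative: an integer vector strictly inside the centred box
that reduces to `z` IS the lift of `z`. [folklore] -/
theorem liftZ_eq_of_castT_eq {z : (μ : Fin d) → ZMod (N μ)} {w : Site d} (hw : castT N w = z)
    (hsmall : ∀ μ, (w μ).natAbs * 2 < N μ) : liftZ z = w := by
  funext μ
  apply (ZMod.valMinAbs_spec (z μ) (w μ)).mpr
  refine ⟨(congrFun hw μ).symm, ?_, ?_⟩
  · have h := hsmall μ
    rcases Int.natAbs_eq (w μ) with h' | h' <;> omega
  · have h := hsmall μ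
    rcases Int.natAbs_eq (w μ) with h' | h' <;> omega

/-- TRANSPORT OF A UNIT STEP (interior case): if `liftZ z` lies in `cube 0 R` and the cube
`cube 0 (R+1)` sits strictly inside the centred box, lifting commutes with a unit step.
[folklore] -/
theorem liftZ_add_castT {z : (μ : Fin d) → ZMod (N μ)} {R : ℕ} (hz : liftZ z ∈ cube 0 R)
    (hR : ∀ μ, (R + 1) * 2 < N μ) {e : Site d} (he : supNorm e ≤ 1) :
    liftZ (z + castT N e) = liftZ z + e := by
  apply liftZ_eq_of_castT_eq
  · rw [castT_add, castT_liftZ]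
  · intro μ
    have h1 : liftZ z + e ∈ cube 0 (R + 1) := add_mem_cube_succ hz he
    rw [mem_cube] at h1
    have h2 : ((liftZ z + e) μ).natAbs ≤ R + 1 := by
      rw [natAbs_le_iff_abs_le]
      have := h1 μ
      simp only [Pi.zero_apply, sub_zero] at this
      exact_mod_cast this
    have := hR μ
    omega

/-- TRANSPORT OF A UNIT STEP (exterior case): if `liftZ z` lies outside `cube 0 (R+2)` (and that
cube sits strictly inside the centred box), a unit step does not bring the lift into `cube 0 R`.
[folklore] -/
theorem liftZ_add_castT_not_mem {z : (μ : Fin d) → ZMod (N μ)} {R : ℕ}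
    (hz : liftZ z ∉ cube 0 (R + 2)) (hR : ∀ μ, (R + 2) * 2 < N μ) {e : Site d}
    (he : supNorm e ≤ 1) : liftZ (z + castT N e) ∉ cube 0 R := by
  intro hmem
  have he' : supNorm (-e) ≤ 1 := by rwa [supNorm_neg]
  have h1 : liftZ (z + castT N e + castT N (-e)) = liftZ (z + castT N e) + (-e) :=
    liftZ_add_castT hmem (fun μ => by have := hR μ; omega) he'
  have h2 : z + castT N e + castT N (-e) = z := by rw [castT_neg]; abel
  rw [h2] at h1
  apply hz
  have h3 : liftZ (z + castT N e) + (-e) ∈ cube 0 (R + 1) := add_mem_cube_succ hmem he'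
  rw [← h1] at h3
  exact cube_mono (by omega) h3

/-- **The torus parametrix equation** `Δ_𝕋 h_{x₀} = -δ_{x₀} + ρ_{x₀}`, valid as soon as the
`3m`-cube and its neighbours fit strictly inside one period (`6m + 6 ≤ N_μ`). [folklore] -/
theorem lapT_paramT (hd : 3 ≤ d) {m : ℕ} (hm : 1 ≤ m) (hNm : ∀ μ, 6 * m + 6 ≤ N μ)
    (x₀ x : (μ : Fin d) → ZMod (N μ)) :
    lapT (paramT m x₀) x = -(if x = x₀ then 1 else 0) + residT m x₀ x := by
  set z := x - x₀ with hz
  have hpl : ∀ i : Fin d, x + Pi.single i 1 - x₀ = z + castT N (Pi.single i 1) := by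
    intro i; rw [castT_single, hz]; abel
  have hmi : ∀ i : Fin d, x - Pi.single i 1 - x₀ = z + castT N (-Pi.single i 1) := by
    intro i; rw [castT_neg, castT_single, hz]; abel
  have hes : ∀ i : Fin d, supNorm (Pi.single i (1 : ℤ) : Site d) ≤ 1 := supNorm_single_one
  have hes' : ∀ i : Fin d, supNorm (-(Pi.single i (1 : ℤ) : Site d)) ≤ 1 := fun i => by
    rw [supNorm_neg]; exact hes i
  by_cases hin : liftZ z ∈ cube 0 (3 * m + 1)
  · -- interior: the stencil transports verbatim
    have hR : ∀ μ, (3 * m + 1 + 1) * 2 < N μ := fun μ => by have := hNm μ; omega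
    have hlap : lapT (paramT m x₀) x = latticeLaplacianZd (param m 0) (liftZ z) := by
      rw [lapT, latticeLaplacianZd_def]
      congr 1
      refine Finset.sum_congr rfl fun i _ => ?_
      simp only [paramT]
      rw [hpl i, hmi i, liftZ_add_castT hin hR (hes i), liftZ_add_castT hin hR (hes' i),
        ← sub_eq_add_neg]
    rw [hlap, lap_param hd]
    have hδ : (if liftZ z = 0 then (1 : ℝ) else 0) = (if x = x₀ then 1 else 0) := by
      by_cases hx : x = x₀
      · rw [if_pos hx, if_pos (by rw [liftZ_eq_zero_iff, hz, hx, sub_self])]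
      · rw [if_neg hx, if_neg (by rw [liftZ_eq_zero_iff, hz, sub_eq_zero]; exact hx)]
    rw [hδ]
    rfl
  · -- exterior: every term vanishes
    have hR : ∀ μ, (3 * m - 1 + 2) * 2 < N μ := fun μ => by have := hNm μ; omega
    have hz' : liftZ z ∉ cube 0 (3 * m - 1 + 2) := by
      have : 3 * m - 1 + 2 = 3 * m + 1 := by omega
      rwa [this]
    have h0 : param m 0 (liftZ z) = 0 :=
      param_eq_zero_of_not_mem hm fun h => hin (cube_mono (by omega) h)
    have hρ : resid m 0 (liftZ z) = 0 :=
      resid_eq_zero_of_not_mem hm fun h => hin (cube_mono (by omega) h)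
    have hx : x ≠ x₀ := by
      intro hx
      apply hin
      rw [hz, hx, sub_self, liftZ_zero, mem_cube_zero_iff, supNorm_zero]
      exact Nat.zero_le _
    have hnb : ∀ i : Fin d,
        paramT m x₀ (x + Pi.single i 1) = 0 ∧ paramT m x₀ (x - Pi.single i 1) = 0 := by
      intro i
      simp only [paramT]
      rw [hpl i, hmi i]
      exact ⟨param_eq_zero_of_not_mem hm (liftZ_add_castT_not_mem hz' hR (hes i)),
        param_eq_zero_of_not_mem hm (liftZ_add_castT_not_mem hz' hR (hes' i))⟩
    have hc : paramT m x₀ x = 0 := h0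
    have hr : residT m x₀ x = 0 := hρ
    rw [lapT, hc, hr, if_neg hx]
    simp only [neg_zero, add_zero, mul_zero, sub_zero]
    exact Finset.sum_eq_zero fun i _ => by rw [(hnb i).1, (hnb i).2, add_zero]

end Torus

/-! ### §3b Envelopes on the torus, with constants quantified BEFORE the volume `N` and the
centre `x₀` -/

section TorusEnvelopes

variable {d : ℕ}

/-- `|h_{x₀}(x)| ≤ C₀ |liftZ (x - x₀)|^{2-d}`, `C₀ = C₀(d)`. [folklore] -/
theorem abs_paramT_le (hd : 3 ≤ d) : ∃ C₀ : ℝ, 0 ≤ C₀ ∧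
    ∀ (N : Fin d → ℕ) [∀ μ, NeZero (N μ)] (m : ℕ), 1 ≤ m →
      ∀ x₀ x : (μ : Fin d) → ZMod (N μ),
        |paramT m x₀ x| ≤ C₀ / nrm (liftZ (x - x₀)) ^ (d - 2) := by
  obtain ⟨C₀, hC₀, h⟩ := abs_param_le hd
  refine ⟨C₀, hC₀, fun N _ m hm x₀ x => ?_⟩
  have := h m hm 0 (liftZ (x - x₀))
  rwa [sub_zero] at this

/-- `|h_{x₀}(x + eᵢ) - h_{x₀}(x)| ≤ C |liftZ (x - x₀)|^{1-d}` in the interior (`liftZ (x - x₀)`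
in the `3m+1`-cube, which sits inside one period), `C = C(d)`. [folklore] -/
theorem abs_paramT_diff_le (hd : 3 ≤ d) : ∃ C : ℝ, 0 ≤ C ∧
    ∀ (N : Fin d → ℕ) [∀ μ, NeZero (N μ)] (m : ℕ), 1 ≤ m → (∀ μ, 6 * m + 6 ≤ N μ) →
      ∀ (x₀ x : (μ : Fin d) → ZMod (N μ)) (i : Fin d), liftZ (x - x₀) ∈ cube 0 (3 * m + 1) →
        |paramT m x₀ (x + Pi.single i 1) - paramT m x₀ x| ≤ C / nrm (liftZ (x - x₀)) ^ (d - 1) := by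
  obtain ⟨C, hC, h⟩ := abs_param_diff_le hd
  refine ⟨C, hC, fun N _ m hm hNm x₀ x i hin => ?_⟩
  have hR : ∀ μ, (3 * m + 1 + 1) * 2 < N μ := fun μ => by have := hNm μ; omega
  have e1 : x + Pi.single i 1 - x₀ = (x - x₀) + castT N (Pi.single i 1) := by
    rw [castT_single]; abel
  simp only [paramT]
  rw [e1, liftZ_add_castT hin hR (supNorm_single_one i)]
  have := h m hm 0 (liftZ (x - x₀)) i
  rwa [sub_zero] at this

/-- `|ρ_{x₀}(x)| ≤ C_ρ m^{-d}` everywhere, `C_ρ = C_ρ(d)`. [folklore] -/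
theorem abs_residT_le (hd : 3 ≤ d) : ∃ Cρ : ℝ, 0 ≤ Cρ ∧
    ∀ (N : Fin d → ℕ) [∀ μ, NeZero (N μ)] (m : ℕ), 1 ≤ m →
      ∀ x₀ x : (μ : Fin d) → ZMod (N μ), |residT m x₀ x| ≤ Cρ / (m : ℝ) ^ d := by
  obtain ⟨Cρ, hCρ, h⟩ := abs_resid_le hd
  exact ⟨Cρ, hCρ, fun N _ m hm x₀ x => h m hm 0 _⟩

/-- `∑_x |h_{x₀}(x)| ≤ C m²` on the torus, `C = C(d)` (the lift is injective and the parametrix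
vanishes off the `3m`-cube). [folklore] -/
theorem sum_abs_paramT_le (hd : 3 ≤ d) : ∃ C : ℝ, 0 ≤ C ∧
    ∀ (N : Fin d → ℕ) [∀ μ, NeZero (N μ)] (m : ℕ), 1 ≤ m →
      ∀ x₀ : (μ : Fin d) → ZMod (N μ), ∑ x, |paramT m x₀ x| ≤ C * (m : ℝ) ^ 2 := by
  obtain ⟨C, hC, h⟩ := sum_abs_param_le hd
  refine ⟨C, hC, fun N _ m hm x₀ => ?_⟩
  classical
  set g : ((μ : Fin d) → ZMod (N μ)) → Site d := fun x => liftZ (x - x₀) with hg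
  have hinj : ∀ a ∈ (Finset.univ : Finset ((μ : Fin d) → ZMod (N μ))), ∀ b ∈ Finset.univ,
      g a = g b → a = b := by
    intro a _ b _ hab
    have := liftZ_injective hab
    simpa using this
  have step1 : ∑ x, |paramT m x₀ x| = ∑ w ∈ Finset.univ.image g, |param m 0 w| := by
    rw [Finset.sum_image hinj]
    simp only [hg, paramT]
  rw [step1]
  have step2 : ∑ w ∈ Finset.univ.image g, |param m 0 w| =
      ∑ w ∈ (Finset.univ.image g).filter (fun w => w ∈ cube (0 : Site d) (3 * m - 1)),
        |param m 0 w| := by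
    rw [Finset.sum_filter_of_ne]
    intro w _ hw
    by_contra hmem
    exact hw (by rw [param_eq_zero_of_not_mem hm hmem, abs_zero])
  rw [step2]
  calc ∑ w ∈ (Finset.univ.image g).filter (fun w => w ∈ cube (0 : Site d) (3 * m - 1)),
        |param m 0 w|
      ≤ ∑ w ∈ cube (0 : Site d) (3 * m - 1), |param m 0 w| :=
        Finset.sum_le_sum_of_subset_of_nonneg (fun w hw => (Finset.mem_filter.mp hw).2)
          (fun w _ _ => abs_nonneg _)
    _ ≤ C * (m : ℝ) ^ 2 := h m hm 0

end TorusEnvelopes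

end Literature.MathematicalPhysics.QuantumFieldTheory.Balaban1983to89.Beta.VectorTails
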